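import Summits.Ventures.CertifiedQuantumChemistry.Rows.FrozenCoreRelaxationPair
import HarnessLib

/-!
# Ventures/CertifiedQuantumChemistry — Rows/FrozenCoreRelaxationBlocks.lean: the blocks of the
# frozen-core extension `(γ', Γ')` of an abstract pair, and two more `0/1` pair matrices

HONEST FRAMING (verbatim): certified bounds for a stated model Hamiltonian in a stated basis; not a
claim about the real molecule beyond that model.

Seat rdm-B (gen 22), file 2 of the relaxation-level frozen-core set (file 1:
`Rows/FrozenCoreRelaxationPair.lean` — the definitions `frozenOne e K γ = E γ Eᴴ + ¹D(|K⟩)`,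
`frozenTwo e K γ Γ = E₂ Γ E₂ᴴ + Σ_{k∈K} F_k γ F_kᴴ + ²D(|K⟩)` and the `D`-condition). Here:

* the 4 + 16 BLOCK ENTRIES of the extended pair, pattern by pattern — pattern names list the four index
  slots (row₁ row₂ column₁ column₂), `I` = image (active) orbital `e i`, `E` = environment orbital
  `m ∉ rangeF e`: `frozenOne_apply_apply` (`γ'_{e i, e j} = γ_ij`), `frozenOne_env_env`
  (`γ'_{m m'} = [m = m' ∈ K]`), `frozenOne_apply_env` / `frozenOne_env_apply` (`0`); `frozenTwo_active`
  (`Γ`), the Coulomb blocks `frozenTwo_IEIE` / `frozenTwo_EIEI` (`[m = m' ∈ K] γ_ij`), the exchange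
  blocks `frozenTwo_IEEI` / `frozenTwo_EIIE` (`−[m = m' ∈ K] γ_ij`), the environment block
  `frozenTwo_env` (the two-matrix of `|K⟩`, HJO (1.7.33)) and the ten dead blocks — literally the
  statements of `Literature/…/FrozenCoreDensityMatrices.lean` with `¹D(ψ) ↦ γ`, `²D(ψ) ↦ Γ`, `⟨ψ,ψ⟩ ↦ 1`;
* two more `0/1` pair matrices `activeEnv e m` (`i ↦ (e i, m)`) and `envActive e m` (`j ↦ (m, e j)`)
  (`mixedPair e m = activeEnv e m − envActive e m`) with the entries of the congruence sums
  `Σ_{s∈S} P_s M P_sᴴ`, `Σ_{s∈S} Q_s M Q_sᴴ` — the active-particle / environment-hole and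
  environment-particle / active-hole blocks of the particle-hole matrix of the extension
  (`FrozenCoreRelaxationParticleHole.lean`) — and `embTwo_mulVec_*` (the pair embedding on vectors).

All PROVED (0 sorry); two definitions, no row, no certificate, nothing about a deposited model.
References: T. Helgaker, P. Jørgensen, J. Olsen, *Molecular Electronic-Structure Theory* (2000)
(1.7.17), (1.7.33), §12.5.1 [HelgakerJorgensenOlsen2000]; D. A. Mazziotti, Adv. Chem. Phys. 134 (2007)
ch. 3 §II.B [Mazziotti2007RDMChapter].
-/

noncomputable section

namespace Summit.Ventures.CertifiedQuantumChemistry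

open Matrix Finset
open Literature.MathematicalPhysics.QuantumLattice Literature.MathematicalPhysics.QuantumChemistry JWEmbed
open scoped ComplexOrder

variable {ι ι' : Type*} [LinearOrder ι] [LinearOrder ι'] [Fintype ι] [Fintype ι']
variable (e : ι ↪o ι') {K : Finset ι'}

/-! ## The blocks of the extended one-matrix -/

section Blocks

variable (γ : Matrix ι ι ℂ) (Γ : Matrix (ι × ι) (ι × ι) ℂ)

/-- **Active block of `γ'`**: `γ'_{e i, e j} = γ_ij`. -/
theorem frozenOne_apply_apply (hK : Disjoint K (rangeF e)) (i j : ι) :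
    frozenOne e K γ (e i) (e j) = γ i j := by
  rw [frozenOne, Matrix.add_apply, embOne_mul_mul_apply_apply, oneRDM_single]
  simp only [apply_mem_iff e hK, and_false, if_false, add_zero]

/-- **Environment block of `γ'`**: `γ'_{m m'} = [m = m' ∈ K]`. -/
theorem frozenOne_env_env {m m' : ι'} (hm : m ∉ rangeF e) :
    frozenOne e K γ m m' = if m = m' ∧ m' ∈ K then 1 else 0 := by
  rw [frozenOne, Matrix.add_apply, embOne_mul_mul_env_left e γ hm, zero_add, oneRDM_single]

/-- **Mixed blocks of `γ'` vanish**: `γ'_{e i, m} = 0`. -/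
theorem frozenOne_apply_env {m : ι'} (hm : m ∉ rangeF e) (i : ι) : frozenOne e K γ (e i) m = 0 := by
  rw [frozenOne, Matrix.add_apply, embOne_mul_mul_env_right e γ hm, zero_add, oneRDM_single]
  simp only [apply_eq_env_iff e hm, false_and, if_false]

/-- **Mixed blocks of `γ'` vanish**: `γ'_{m, e j} = 0`. -/
theorem frozenOne_env_apply {m : ι'} (hm : m ∉ rangeF e) (j : ι) : frozenOne e K γ m (e j) = 0 := by
  rw [frozenOne, Matrix.add_apply, embOne_mul_mul_env_left e γ hm, zero_add, oneRDM_single]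
  simp only [env_eq_apply_iff e hm, false_and, if_false]

/-! ## The blocks of the extended two-matrix: live blocks

Pattern names list the four index slots (row₁ row₂ column₁ column₂): `I` = image (active) orbital
`e i`, `E` = environment orbital `m ∉ rangeF e`. -/

/-- **All-active block of `Γ'`**: `Γ'_{(e i, e k),(e j, e l)} = Γ_{(i,k),(j,l)}`. -/
theorem frozenTwo_active (hK : Disjoint K (rangeF e)) (i k j l : ι) :
    frozenTwo e K γ Γ (e i, e k) (e j, e l) = Γ (i, k) (j, l) := by
  rw [frozenTwo, Matrix.add_apply, Matrix.add_apply, embTwo_mul_mul_active, sum_mixedPair_mul_mul_active_row e γ hK,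
    twoRDM_single]
  simp only [apply_mem_iff e hK, and_false, if_false, add_zero]

/-- **Coulomb block** `Γ'_{(e i, m),(e j, m')} = [m = m' ∈ K] γ_ij`. -/
theorem frozenTwo_IEIE (hK : Disjoint K (rangeF e)) (i j : ι) {m m' : ι'} (hm : m ∉ rangeF e) :
    frozenTwo e K γ Γ (e i, m) (e j, m') = if m = m' ∧ m' ∈ K then γ i j else 0 := by
  rw [frozenTwo, Matrix.add_apply, Matrix.add_apply, embTwo_mul_mul_env_snd e Γ hm, sum_mixedPair_mul_mul_IEIE e γ hK,
    twoRDM_single]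
  simp only [apply_mem_iff e hK, and_false, if_false, add_zero, zero_add]

/-- **Coulomb block** `Γ'_{(m, e i),(m', e j)} = [m = m' ∈ K] γ_ij`. -/
theorem frozenTwo_EIEI (hK : Disjoint K (rangeF e)) (i j : ι) {m m' : ι'} (hm : m ∉ rangeF e) :
    frozenTwo e K γ Γ (m, e i) (m', e j) = if m = m' ∧ m' ∈ K then γ i j else 0 := by
  rw [frozenTwo, Matrix.add_apply, Matrix.add_apply, embTwo_mul_mul_env_fst e Γ hm, sum_mixedPair_mul_mul_EIEI e γ hK,
    twoRDM_single]
  simp only [apply_mem_iff e hK, false_and, if_false, add_zero, zero_add]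

/-- **Exchange block** `Γ'_{(e i, m),(m', e j)} = −[m = m' ∈ K] γ_ij`. -/
theorem frozenTwo_IEEI (hK : Disjoint K (rangeF e)) (i j : ι) {m m' : ι'} (hm : m ∉ rangeF e) :
    frozenTwo e K γ Γ (e i, m) (m', e j) = if m = m' ∧ m' ∈ K then -γ i j else 0 := by
  rw [frozenTwo, Matrix.add_apply, Matrix.add_apply, embTwo_mul_mul_env_snd e Γ hm, sum_mixedPair_mul_mul_IEEI e γ hK,
    twoRDM_single]
  simp only [apply_mem_iff e hK, false_and, if_false, add_zero, zero_add]

/-- **Exchange block** `Γ'_{(m, e i),(e j, m')} = −[m = m' ∈ K] γ_ij`. -/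
theorem frozenTwo_EIIE (hK : Disjoint K (rangeF e)) (i j : ι) {m m' : ι'} (hm : m ∉ rangeF e) :
    frozenTwo e K γ Γ (m, e i) (e j, m') = if m = m' ∧ m' ∈ K then -γ i j else 0 := by
  rw [frozenTwo, Matrix.add_apply, Matrix.add_apply, embTwo_mul_mul_env_fst e Γ hm, sum_mixedPair_mul_mul_EIIE e γ hK,
    twoRDM_single]
  simp only [apply_mem_iff e hK, and_false, if_false, add_zero, zero_add]

/-- **Environment block** (the two-matrix of `|K⟩`, HJO (1.7.33)):
`Γ'_{(m₁,m₃),(m₂,m₄)} = [m₂, m₄ ∈ K]([m₁ = m₂][m₃ = m₄] − [m₁ = m₄][m₃ = m₂])`. -/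
theorem frozenTwo_env {m₁ m₃ : ι'} (hm₁ : m₁ ∉ rangeF e) (hm₃ : m₃ ∉ rangeF e) (m₂ m₄ : ι') :
    frozenTwo e K γ Γ (m₁, m₃) (m₂, m₄) =
      if m₄ ∈ K ∧ m₂ ∈ K then
        (if m₁ = m₂ ∧ m₃ = m₄ then (1 : ℂ) else 0) - (if m₁ = m₄ ∧ m₃ = m₂ then (1 : ℂ) else 0) else 0 := by
  rw [frozenTwo, Matrix.add_apply, Matrix.add_apply, embTwo_mul_mul_env_fst e Γ hm₁,
    sum_mixedPair_mul_mul_env_row e γ K hm₁ hm₃, twoRDM_single, zero_add, zero_add]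

/-! ## The blocks of the extended two-matrix: dead blocks -/

/-- One environment index among four: `Γ'_{(e i, e k),(e j, m)} = 0`. -/
theorem frozenTwo_IIIE (hK : Disjoint K (rangeF e)) (i k j : ι) {m : ι'} (hm : m ∉ rangeF e) :
    frozenTwo e K γ Γ (e i, e k) (e j, m) = 0 := by
  rw [frozenTwo, Matrix.add_apply, Matrix.add_apply, embTwo_mul_mul_env_snd' e Γ hm,
    sum_mixedPair_mul_mul_active_row e γ hK, twoRDM_single]
  simp only [apply_mem_iff e hK, and_false, if_false, add_zero]

/-- One environment index among four: `Γ'_{(e i, e k),(m, e l)} = 0`. -/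
theorem frozenTwo_IIEI (hK : Disjoint K (rangeF e)) (i k l : ι) {m : ι'} (hm : m ∉ rangeF e) :
    frozenTwo e K γ Γ (e i, e k) (m, e l) = 0 := by
  rw [frozenTwo, Matrix.add_apply, Matrix.add_apply, embTwo_mul_mul_env_fst' e Γ hm,
    sum_mixedPair_mul_mul_active_row e γ hK, twoRDM_single]
  simp only [apply_mem_iff e hK, false_and, if_false, add_zero]

/-- One environment index among four: `Γ'_{(e i, m),(e j, e l)} = 0`. -/
theorem frozenTwo_IEII (hK : Disjoint K (rangeF e)) (i j l : ι) {m : ι'} (hm : m ∉ rangeF e) :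
    frozenTwo e K γ Γ (e i, m) (e j, e l) = 0 := by
  rw [frozenTwo, Matrix.add_apply, Matrix.add_apply, embTwo_mul_mul_env_snd e Γ hm,
    sum_mixedPair_mul_mul_active_col e γ hK, twoRDM_single]
  simp only [apply_mem_iff e hK, false_and, if_false, add_zero]

/-- One environment index among four: `Γ'_{(m, e k),(e j, e l)} = 0`. -/
theorem frozenTwo_EIII (hK : Disjoint K (rangeF e)) (k j l : ι) {m : ι'} (hm : m ∉ rangeF e) :
    frozenTwo e K γ Γ (m, e k) (e j, e l) = 0 := by
  rw [frozenTwo, Matrix.add_apply, Matrix.add_apply, embTwo_mul_mul_env_fst e Γ hm,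
    sum_mixedPair_mul_mul_active_col e γ hK, twoRDM_single]
  simp only [apply_mem_iff e hK, false_and, if_false, add_zero]

/-- Two environment annihilators: `Γ'_{(e i, e k),(m, m')} = 0`. -/
theorem frozenTwo_IIEE (hK : Disjoint K (rangeF e)) (i k : ι) {m m' : ι'} (hm : m ∉ rangeF e)
    (hm' : m' ∉ rangeF e) : frozenTwo e K γ Γ (e i, e k) (m, m') = 0 := by
  rw [frozenTwo, Matrix.add_apply, Matrix.add_apply, embTwo_mul_mul_env_fst' e Γ hm,
    sum_mixedPair_mul_mul_active_row e γ hK, twoRDM_single]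
  simp only [apply_eq_env_iff e hm, apply_eq_env_iff e hm', false_and, if_false, sub_self, ite_self,
    add_zero]

/-- Two environment creators: `Γ'_{(m, m'),(e j, e l)} = 0`. -/
theorem frozenTwo_EEII (hK : Disjoint K (rangeF e)) (j l : ι) {m m' : ι'} (hm : m ∉ rangeF e)
    (hm' : m' ∉ rangeF e) : frozenTwo e K γ Γ (m, m') (e j, e l) = 0 := by
  rw [frozenTwo, Matrix.add_apply, Matrix.add_apply, embTwo_mul_mul_env_fst e Γ hm,
    sum_mixedPair_mul_mul_env_row e γ K hm hm', twoRDM_single]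
  simp only [apply_mem_iff e hK, false_and, if_false, add_zero]

/-- Three environment indices: `Γ'_{(m₁, m₃),(m₂, e l)} = 0`. -/
theorem frozenTwo_EEEI (hK : Disjoint K (rangeF e)) (l : ι) {m₁ m₂ m₃ : ι'} (hm₁ : m₁ ∉ rangeF e)
    (hm₃ : m₃ ∉ rangeF e) : frozenTwo e K γ Γ (m₁, m₃) (m₂, e l) = 0 := by
  rw [frozenTwo, Matrix.add_apply, Matrix.add_apply, embTwo_mul_mul_env_fst e Γ hm₁,
    sum_mixedPair_mul_mul_env_row e γ K hm₁ hm₃, twoRDM_single]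
  simp only [apply_mem_iff e hK, false_and, if_false, add_zero]

/-- Three environment indices: `Γ'_{(m₁, e k),(m₂, m₄)} = 0`. -/
theorem frozenTwo_EIEE (k : ι) {m₁ m₂ m₄ : ι'} (hm₁ : m₁ ∉ rangeF e) (hm₂ : m₂ ∉ rangeF e)
    (hm₄ : m₄ ∉ rangeF e) : frozenTwo e K γ Γ (m₁, e k) (m₂, m₄) = 0 := by
  rw [frozenTwo, Matrix.add_apply, Matrix.add_apply, embTwo_mul_mul_env_fst e Γ hm₁,
    sum_mixedPair_mul_mul_env_col e γ K hm₂ hm₄, twoRDM_single]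
  simp only [apply_eq_env_iff e hm₂, apply_eq_env_iff e hm₄, and_false, if_false, sub_self, ite_self,
    add_zero]

/-- Three environment indices: `Γ'_{(m₁, m₃),(e j, m₄)} = 0`. -/
theorem frozenTwo_EEIE (hK : Disjoint K (rangeF e)) (j : ι) {m₁ m₃ m₄ : ι'} (hm₁ : m₁ ∉ rangeF e)
    (hm₃ : m₃ ∉ rangeF e) : frozenTwo e K γ Γ (m₁, m₃) (e j, m₄) = 0 := by
  rw [frozenTwo, Matrix.add_apply, Matrix.add_apply, embTwo_mul_mul_env_fst e Γ hm₁,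
    sum_mixedPair_mul_mul_env_row e γ K hm₁ hm₃, twoRDM_single]
  simp only [apply_mem_iff e hK, and_false, if_false, add_zero]

/-- Three environment indices: `Γ'_{(e i, m₃),(m₂, m₄)} = 0`. -/
theorem frozenTwo_IEEE (i : ι) {m₂ m₃ m₄ : ι'} (hm₂ : m₂ ∉ rangeF e) (hm₃ : m₃ ∉ rangeF e)
    (hm₄ : m₄ ∉ rangeF e) : frozenTwo e K γ Γ (e i, m₃) (m₂, m₄) = 0 := by
  rw [frozenTwo, Matrix.add_apply, Matrix.add_apply, embTwo_mul_mul_env_snd e Γ hm₃,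
    sum_mixedPair_mul_mul_env_col e γ K hm₂ hm₄, twoRDM_single]
  simp only [apply_eq_env_iff e hm₂, apply_eq_env_iff e hm₄, false_and, if_false, sub_self, ite_self,
    add_zero]

end Blocks

/-! ## Two more `0/1` pair matrices (used for the particle-hole matrix of the extension) -/

/-- The `0/1` matrix sending the active orbital `i` to the pair `(e i, m)` (active particle slot, fixed
environment orbital `m` in the second slot): `P_m_{(p,q), i} = [p = e i][q = m]`. -/
def activeEnv (e : ι ↪o ι') (m : ι') : Matrix (ι' × ι') ι ℂ :=
  Matrix.of fun p i => if p.1 = e i ∧ p.2 = m then 1 else 0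

/-- The `0/1` matrix sending the active orbital `j` to the pair `(m, e j)` (fixed environment orbital
`m` in the first slot): `Q_m_{(p,q), j} = [p = m][q = e j]`. -/
def envActive (e : ι ↪o ι') (m : ι') : Matrix (ι' × ι') ι ℂ :=
  Matrix.of fun p j => if p.1 = m ∧ p.2 = e j then 1 else 0

omit [Fintype ι] [Fintype ι'] in
/-- Entries of `activeEnv`. -/
@[simp] theorem activeEnv_apply (m : ι') (p : ι' × ι') (i : ι) :
    activeEnv e m p i = if p.1 = e i ∧ p.2 = m then 1 else 0 := rfl

omit [Fintype ι] [Fintype ι'] in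
/-- Entries of `(activeEnv e m)ᴴ` (the matrix is real). -/
@[simp] theorem activeEnv_conjTranspose_apply (m : ι') (i : ι) (p : ι' × ι') :
    (activeEnv e m)ᴴ i p = if p.1 = e i ∧ p.2 = m then 1 else 0 := by
  rw [conjTranspose_apply, activeEnv_apply]
  split_ifs <;> simp

omit [Fintype ι] [Fintype ι'] in
/-- Entries of `envActive`. -/
@[simp] theorem envActive_apply (m : ι') (p : ι' × ι') (j : ι) :
    envActive e m p j = if p.1 = m ∧ p.2 = e j then 1 else 0 := rfl

omit [Fintype ι] [Fintype ι'] in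
/-- Entries of `(envActive e m)ᴴ` (the matrix is real). -/
@[simp] theorem envActive_conjTranspose_apply (m : ι') (j : ι) (p : ι' × ι') :
    (envActive e m)ᴴ j p = if p.1 = m ∧ p.2 = e j then 1 else 0 := by
  rw [conjTranspose_apply, envActive_apply]
  split_ifs <;> simp

section PiecesPH

variable (M : Matrix ι ι ℂ)

omit [Fintype ι'] in
/-- One term `P_s M P_sᴴ` at general indices. -/
theorem activeEnv_mul_mul_apply (s : ι') (p q : ι' × ι') :
    (activeEnv e s * M * (activeEnv e s)ᴴ) p q =
      ∑ i, ∑ j, (if p.1 = e i ∧ p.2 = s then 1 else 0) * M i j * (if q.1 = e j ∧ q.2 = s then 1 else 0) := by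
  simp only [Matrix.mul_apply, activeEnv_apply, activeEnv_conjTranspose_apply, Finset.sum_mul]
  exact Finset.sum_comm

omit [Fintype ι'] in
/-- One term `Q_s M Q_sᴴ` at general indices. -/
theorem envActive_mul_mul_apply (s : ι') (p q : ι' × ι') :
    (envActive e s * M * (envActive e s)ᴴ) p q =
      ∑ i, ∑ j, (if p.1 = s ∧ p.2 = e i then 1 else 0) * M i j * (if q.1 = s ∧ q.2 = e j then 1 else 0) := by
  simp only [Matrix.mul_apply, envActive_apply, envActive_conjTranspose_apply, Finset.sum_mul]
  exact Finset.sum_comm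

omit [Fintype ι'] in
/-- `Σ_{s∈S} P_s M P_sᴴ` vanishes unless the first row slot is active. -/
theorem sum_activeEnv_mul_mul_env_row (S : Finset ι') {m : ι'} (hm : m ∉ rangeF e) (p' : ι')
    (q : ι' × ι') : (∑ s ∈ S, activeEnv e s * M * (activeEnv e s)ᴴ) (m, p') q = 0 := by
  rw [Matrix.sum_apply]
  refine Finset.sum_eq_zero fun s _ => ?_
  simp only [activeEnv_mul_mul_apply, env_eq_apply_iff e hm, false_and, if_false, zero_mul,
    Finset.sum_const_zero]

omit [Fintype ι'] in
/-- `Σ_{s∈S} P_s M P_sᴴ` vanishes unless the first column slot is active. -/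
theorem sum_activeEnv_mul_mul_env_col (S : Finset ι') {m : ι'} (hm : m ∉ rangeF e) (p : ι' × ι')
    (q' : ι') : (∑ s ∈ S, activeEnv e s * M * (activeEnv e s)ᴴ) p (m, q') = 0 := by
  rw [Matrix.sum_apply]
  refine Finset.sum_eq_zero fun s _ => ?_
  simp only [activeEnv_mul_mul_apply, env_eq_apply_iff e hm, false_and, if_false, mul_zero,
    Finset.sum_const_zero]

omit [Fintype ι'] in
/-- `Σ_{s∈S} P_s M P_sᴴ` (`S` in the environment) vanishes when the second row slot is active. -/
theorem sum_activeEnv_mul_mul_active_row (S : Finset ι') (hS : Disjoint S (rangeF e)) (p' : ι') (k : ι)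
    (q : ι' × ι') : (∑ s ∈ S, activeEnv e s * M * (activeEnv e s)ᴴ) (p', e k) q = 0 := by
  rw [Matrix.sum_apply]
  refine Finset.sum_eq_zero fun s hs => ?_
  simp only [activeEnv_mul_mul_apply, apply_eq_env_iff e (not_mem_rangeF_of_mem e hS hs), and_false,
    if_false, zero_mul, Finset.sum_const_zero]

omit [Fintype ι'] in
/-- `Σ_{s∈S} P_s M P_sᴴ` (`S` in the environment) vanishes when the second column slot is active. -/
theorem sum_activeEnv_mul_mul_active_col (S : Finset ι') (hS : Disjoint S (rangeF e)) (p : ι' × ι')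
    (q' : ι') (l : ι) : (∑ s ∈ S, activeEnv e s * M * (activeEnv e s)ᴴ) p (q', e l) = 0 := by
  rw [Matrix.sum_apply]
  refine Finset.sum_eq_zero fun s hs => ?_
  simp only [activeEnv_mul_mul_apply, apply_eq_env_iff e (not_mem_rangeF_of_mem e hS hs), and_false,
    if_false, mul_zero, Finset.sum_const_zero]

omit [Fintype ι'] in
/-- The live block of `Σ_{s∈S} P_s M P_sᴴ`: `((e i, m), (e j, m')) ↦ [m = m' ∈ S] M_ij`. -/
theorem sum_activeEnv_mul_mul_IEIE (S : Finset ι') (i j : ι) (m m' : ι') :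
    (∑ s ∈ S, activeEnv e s * M * (activeEnv e s)ᴴ) (e i, m) (e j, m') =
      if m = m' ∧ m' ∈ S then M i j else 0 := by
  rw [Matrix.sum_apply, ← sum_ite_eq_and_eq S m m' (M i j)]
  refine Finset.sum_congr rfl fun s _ => ?_
  simp only [activeEnv_mul_mul_apply, OrderEmbedding.eq_iff_eq, ite_mul, one_mul, zero_mul, mul_ite,
    mul_one, mul_zero, ite_and, Finset.sum_ite_irrel, Finset.sum_ite_eq, Finset.mem_univ, if_true,
    Finset.sum_const_zero]
  by_cases h1 : m = s <;> by_cases h2 : m' = s <;> simp [h1, h2]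

omit [Fintype ι'] in
/-- `Σ_{s∈S} Q_s M Q_sᴴ` (`S` in the environment) vanishes when the first row slot is active. -/
theorem sum_envActive_mul_mul_active_row (S : Finset ι') (hS : Disjoint S (rangeF e)) (i : ι) (p' : ι')
    (q : ι' × ι') : (∑ s ∈ S, envActive e s * M * (envActive e s)ᴴ) (e i, p') q = 0 := by
  rw [Matrix.sum_apply]
  refine Finset.sum_eq_zero fun s hs => ?_
  simp only [envActive_mul_mul_apply, apply_eq_env_iff e (not_mem_rangeF_of_mem e hS hs), false_and,
    if_false, zero_mul, Finset.sum_const_zero]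

omit [Fintype ι'] in
/-- `Σ_{s∈S} Q_s M Q_sᴴ` (`S` in the environment) vanishes when the first column slot is active. -/
theorem sum_envActive_mul_mul_active_col (S : Finset ι') (hS : Disjoint S (rangeF e)) (p : ι' × ι')
    (j : ι) (q' : ι') : (∑ s ∈ S, envActive e s * M * (envActive e s)ᴴ) p (e j, q') = 0 := by
  rw [Matrix.sum_apply]
  refine Finset.sum_eq_zero fun s hs => ?_
  simp only [envActive_mul_mul_apply, apply_eq_env_iff e (not_mem_rangeF_of_mem e hS hs), false_and,
    if_false, mul_zero, Finset.sum_const_zero]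

omit [Fintype ι'] in
/-- `Σ_{s∈S} Q_s M Q_sᴴ` vanishes when the second row slot is an environment orbital. -/
theorem sum_envActive_mul_mul_env_row (S : Finset ι') (p' : ι') {m : ι'} (hm : m ∉ rangeF e)
    (q : ι' × ι') : (∑ s ∈ S, envActive e s * M * (envActive e s)ᴴ) (p', m) q = 0 := by
  rw [Matrix.sum_apply]
  refine Finset.sum_eq_zero fun s _ => ?_
  simp only [envActive_mul_mul_apply, env_eq_apply_iff e hm, and_false, if_false, zero_mul,
    Finset.sum_const_zero]

omit [Fintype ι'] in
/-- `Σ_{s∈S} Q_s M Q_sᴴ` vanishes when the second column slot is an environment orbital. -/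
theorem sum_envActive_mul_mul_env_col (S : Finset ι') (p : ι' × ι') (q' : ι') {m : ι'}
    (hm : m ∉ rangeF e) : (∑ s ∈ S, envActive e s * M * (envActive e s)ᴴ) p (q', m) = 0 := by
  rw [Matrix.sum_apply]
  refine Finset.sum_eq_zero fun s _ => ?_
  simp only [envActive_mul_mul_apply, env_eq_apply_iff e hm, and_false, if_false, mul_zero,
    Finset.sum_const_zero]

omit [Fintype ι'] in
/-- The live block of `Σ_{s∈S} Q_s M Q_sᴴ`: `((m, e j), (m', e l)) ↦ [m = m' ∈ S] M_jl`. -/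
theorem sum_envActive_mul_mul_EIEI (S : Finset ι') (j l : ι) (m m' : ι') :
    (∑ s ∈ S, envActive e s * M * (envActive e s)ᴴ) (m, e j) (m', e l) =
      if m = m' ∧ m' ∈ S then M j l else 0 := by
  rw [Matrix.sum_apply, ← sum_ite_eq_and_eq S m m' (M j l)]
  refine Finset.sum_congr rfl fun s _ => ?_
  simp only [envActive_mul_mul_apply, OrderEmbedding.eq_iff_eq, ite_mul, one_mul, zero_mul, mul_ite,
    mul_one, mul_zero, ite_and, Finset.sum_ite_irrel, Finset.sum_ite_eq, Finset.mem_univ, if_true,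
    Finset.sum_const_zero]
  by_cases h1 : m = s <;> by_cases h2 : m' = s <;> simp [h1, h2]

omit [Fintype ι'] in
/-- `E₂ w` at an active pair: `(E₂ w)_{(e i, e j)} = w_{(i,j)}`. -/
theorem embTwo_mulVec_active (w : ι × ι → ℂ) (i j : ι) : (embTwo e *ᵥ w) (e i, e j) = w (i, j) := by
  simp only [mulVec, dotProduct, embTwo_apply, OrderEmbedding.eq_iff_eq, Fintype.sum_prod_type, ite_and,
    ite_mul, one_mul, zero_mul, Finset.sum_ite_irrel, Finset.sum_ite_eq, Finset.mem_univ, if_true,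
    Finset.sum_const_zero]

omit [Fintype ι'] in
/-- `E₂ w` vanishes at a pair whose first slot is an environment orbital. -/
theorem embTwo_mulVec_env_fst (w : ι × ι → ℂ) {m : ι'} (hm : m ∉ rangeF e) (p' : ι') :
    (embTwo e *ᵥ w) (m, p') = 0 := by
  simp only [mulVec, dotProduct, embTwo_apply, env_eq_apply_iff e hm, false_and, if_false, zero_mul,
    Finset.sum_const_zero]

omit [Fintype ι'] in
/-- `E₂ w` vanishes at a pair whose second slot is an environment orbital. -/
theorem embTwo_mulVec_env_snd (w : ι × ι → ℂ) {m : ι'} (hm : m ∉ rangeF e) (p' : ι') :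
    (embTwo e *ᵥ w) (p', m) = 0 := by
  simp only [mulVec, dotProduct, embTwo_apply, env_eq_apply_iff e hm, and_false, if_false, zero_mul,
    Finset.sum_const_zero]

end PiecesPH

end Summit.Ventures.CertifiedQuantumChemistry

end
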